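import Literature.NumberTheory.EllipticCurves.KubertTate1314KummerClasses
import Literature.NumberTheory.EllipticCurves.KubertTate1314Rank
import Literature.NumberTheory.EllipticCurves.KubertTateFiveSelmerTame
import HarnessLib

/-!
# `rank E_{13/14}(ℚ) = 2` and `E(ℚ)/5E(ℚ) ≅ (ℤ/5)³`: the complete `μ₅`-side of the `5`-descent on
# rational points of the Kubert–Tate curve `[1, -182, -2548, 0, 0]`

PROOF-ONLY file (theorems only), topic `NumberTheory/EllipticCurves`; sequel of
`KubertTate1314KummerClasses` (Kummer classes of rational points are cancelled by `T₂ = 2T`,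
`P₁ = (-78, 936)`, `P₂ = (98, 392)`) and `KubertTate1314Rank` (`rank ≥ 2`). For
`E = E_{13/14} = kubertTateFive 13 14` with `T = (0,0)` of order `5`, `φ : E → E' = E/⟨T⟩`
(`KubertTateVelu.fiveIsogeny 13 14`):

* `exists_eq_five_nsmul_of_f_eq_pow` — **a rational point `P'' ≠ O, T` with `f_T(P'') ∈ (ℚˣ)⁵` lies in
  `5E(ℚ)`**: the Kummer form of the descent through `⟨T̄⟩` (tree
  `exists_stableCoset_of_kummer_eq_pow`: `5R = P''` with `R + ⟨T̄⟩` `Γ_ℚ`-stable), then `φ R ∈ E'(ℚ)`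
  (Galois descent) and **`E'(ℚ) = φ(E(ℚ))`** (the `ℤ/5`-side `Sel^φ(E/ℚ) = 0` of
  `KubertTateFiveSelmerTame`, tree `ConstantKernelDescent.exists_toGeomPoints_eq_of_selmerGroup_eq_bot`),
  so `R ∈ E(ℚ) + ⟨T̄⟩` and `P'' = 5R ∈ 5E(ℚ)`;
* `exists_sub_combination_mem` — every `P ∈ E(ℚ)` is `≡ iT₂ + jP₁ + kP₂ (mod 5E(ℚ))` with
  `i, j, k < 5`;
* `card_quotient_le` — **`#E(ℚ)/5E(ℚ) ≤ 125`**, hence with `KubertTate1314Rank.card_quotient_ge`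
  `#E(ℚ)/5E(ℚ) = 125`;
* `mordellWeilRank_le_two`, **`mordellWeilRank_eq_two : rank E_{13/14}(ℚ) = 2`** (with
  `#E(ℚ)/5E(ℚ) = 5^{rank}·#E(ℚ)[5]`, `#E(ℚ)[5] = 5`).

Everything is unconditional; no `L`-function, no completion, no conjecture. (What this does NOT give:
`Ш(E/ℚ)[5] = 0`, which is about Selmer classes that are not rational points.)

## References

* [SilvermanAEC2009] J. H. Silverman, *AEC*, 2nd ed., Thm. X.1.1 and its proof, X.4 (Thm. 4.2,
  Prop. 4.9), Exercise 10.1.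
* [Mazur1977] B. Mazur, *Modular curves and the Eisenstein ideal*, Ch. III §3 (descent through a
  constant subgroup).
-/

noncomputable section

open scoped Classical
open WeierstrassCurve Field
open Literature.NumberTheory.EllipticCurves Literature.NumberTheory.EllipticCurves.KubertTateKummer
  Literature.NumberTheory.EllipticCurves.KubertTateVelu

-- The `ℚ`-algebra diamond on `AlgebraicClosure ℚ`: same device as `KubertTate1314Torsion`.
attribute [-instance] DivisionRing.toRatAlgebra

namespace Literature.NumberTheory.EllipticCurves

namespace KubertTate1314Descent

/-! ### `Sel^φ(E/ℚ) = 0`, read for `E = kubertTateFive 13 14` -/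

/-- `Sel^φ(E_{13/14}/ℚ) = 0` (the class-wide theorem of `KubertTateFiveSelmerTame` at `(13, 14)`, with the
integer casts pushed). [cite: Mazur1977, Ch. III §3 Thm. (3.1) with Ch. I §1(g)] -/
theorem selmerGroup_fiveIsogeny_eq_bot : (fiveIsogeny (13 : ℚ) 14).selmerGroup = ⊥ := by
  have h := selmerGroup_fiveIsogeny_eq_bot_13_14
  push_cast at h
  exact h

/-! ### A rational point with fifth-power Kummer value is in `5E(ℚ)` -/

/-- **`f_T(P'') ∈ (ℚˣ)⁵ ⟹ P'' ∈ 5E(ℚ)`** for a rational point `P'' = (x'', y'') ≠ T`: Kummer form of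
the descent through `⟨T̄⟩` (`5R = P''`, `R + ⟨T̄⟩` stable), Galois descent for `φ R`, and
`E'(ℚ) = φ(E(ℚ))` (`Sel^φ = 0`). [cite: SilvermanAEC2009, Exercise 10.1(c) and Thm. X.4.2] -/
theorem exists_eq_five_nsmul_of_f_eq_pow {x'' y'' : ℚ} (h'' : E.toAffine.Nonsingular x'' y'')
    (hT'' : ¬ (x'' = 0 ∧ y'' = 0)) {t : ℚ} (ht0 : t ≠ 0)
    (hf : x'' * y'' - 14 * x'' ^ 2 + 14 ^ 2 * y'' = t ^ 5) :
    ∃ Q₁ : E.toAffine.Point, Affine.Point.some x'' y'' h'' = (5 : ℕ) • Q₁ := by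
  haveI : Fact (Nat.Prime 5) := ⟨Nat.prime_five⟩
  haveI : NeZero ((5 : ℕ) : ℚ) := ⟨by norm_num⟩
  set ι := algebraMap ℚ (AlgebraicClosure ℚ) with hι
  set P'' : E.toAffine.Point := Affine.Point.some x'' y'' h'' with hP''
  have hT5 : ((5 : ℕ) : ℤ) • Tbar (13 : ℚ) 14 = 0 := five_zsmul_Tbar 13 14
  -- the point `P''` over `ℚ̄`
  have hPfix : ∀ σ : absoluteGaloisGroup ℚ, σ • toGeom P'' = toGeom P'' := fun σ ↦ smul_toGeom σ P''
  have hP0 : toGeom P'' ≠ 0 := by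
    rw [hP'']; obtain ⟨h', e⟩ := toGeom_some h''; rw [e]; exact Affine.Point.some_ne_zero _
  have hPT : toGeom P'' ≠ Tbar (13 : ℚ) 14 := by
    rw [← toGeom_T]
    intro e
    have e' := toGeom_injective e
    rw [hP'', T] at e'
    exact hT'' (by have := Affine.Point.some.inj e'; exact ⟨this.1, this.2⟩)
  have ha : E.HasValueAt (kummerFn (13 : ℚ) 14) (toGeom P'') (ι (t ^ 5)) := by
    rw [hP'', ← hf]; exact hasValueAt_point h''
  -- the reference point `R₂ = P₁` (rational: trivially stable coset), `f_T(5P₁) = t₀⁵`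
  have hnsP₁ : E.toAffine.Nonsingular (-78) 936 := (nonsingular_iff _ _).mpr (by norm_num)
  obtain ⟨x₅, y₅, h₅, t₀, e₅, ht₀0, hα₀⟩ := exists_f_five_nsmul_P₁_eq_pow
  obtain ⟨h50, h5T⟩ := five_nsmul_ne (h := hnsP₁) (by norm_num : (-78 : ℚ) ≠ 0) (by norm_num)
  have hR₂ : ∀ σ : absoluteGaloisGroup ℚ, σ • toGeom P₁ - toGeom P₁ ∈ AddSubgroup.zmultiples (Tbar (13 : ℚ) 14) :=
    fun σ ↦ by rw [smul_toGeom, sub_self]; exact zero_mem _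
  have hR₂0 : ((5 : ℕ) : ℤ) • toGeom P₁ ≠ 0 := by
    rw [natCast_zsmul, ← map_nsmul]
    exact fun h ↦ h50 (toGeom_injective (h.trans (map_zero _).symm))
  have hR₂T : ((5 : ℕ) : ℤ) • toGeom P₁ ≠ Tbar (13 : ℚ) 14 := by
    rw [natCast_zsmul, ← map_nsmul, ← toGeom_T]
    exact fun h ↦ h5T (toGeom_injective h)
  have hb : E.HasValueAt (kummerFn (13 : ℚ) 14) (((5 : ℕ) : ℤ) • toGeom P₁) (ι (t₀ ^ 5)) := by
    rw [natCast_zsmul, ← map_nsmul, e₅, ← hα₀]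
    exact hasValueAt_point h₅
  have hab : ι (t ^ 5) = ι (t / t₀) ^ 5 * ι (t₀ ^ 5) := by
    rw [← map_pow, ← map_mul]; congr 1; field_simp
  -- Kummer form of the descent: `5R = P''`, `R + ⟨T̄⟩` stable
  obtain ⟨R, hR5, hRstab⟩ := exists_stableCoset_of_kummer_eq_pow (F := ℚ) (W := E) (N := 5) hT5
    (Tbar_ne_zero 13 14) (smul_Tbar 13 14) (kummerFn_ne_zero 13 14) (ord_kummerFn 13 14) hR₂ hR₂0 hR₂T
    hPfix hP0 hPT ha hb hab
  -- `φ R` is `Γ_ℚ`-fixed, hence rational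
  have hφfix : ∀ σ : absoluteGaloisGroup ℚ, σ • fiveIsogeny (13 : ℚ) 14 R = fiveIsogeny (13 : ℚ) 14 R := by
    intro σ
    have hmem := hRstab σ
    rw [← ker_fiveIsogeny_eq_zmultiples] at hmem
    have h0 : fiveIsogeny (13 : ℚ) 14 (σ • R - R) = 0 := hmem
    rw [map_sub, sub_eq_zero, (fiveIsogeny (13 : ℚ) 14).map_smul] at h0
    exact h0
  obtain ⟨P', hP'⟩ := exists_toGeomPoints_eq_of_forall_smul_eq (W := kubertTateFive' (13 : ℚ) 14) hφfix
  -- `E'(ℚ) = φ(E(ℚ))`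
  obtain ⟨Q₁, hQ₁⟩ := ConstantKernelDescent.exists_toGeomPoints_eq_of_selmerGroup_eq_bot
    (fiveIsogeny (13 : ℚ) 14) selmerGroup_fiveIsogeny_eq_bot P'
  -- `R - Q₁ ∈ ker φ = ⟨T̄⟩`, so `5R = 5Q₁`
  have hker : R - toGeom Q₁ ∈ (fiveIsogeny (13 : ℚ) 14).toAddMonoidHom.ker := by
    rw [AddMonoidHom.mem_ker]
    show fiveIsogeny (13 : ℚ) 14 (R - toGeom Q₁) = 0
    rw [map_sub, ← hP', hQ₁]
    exact sub_self _
  have h5 := five_nsmul_eq_zero_of_mem_ker (13 : ℚ) 14 hker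
  rw [nsmul_sub, sub_eq_zero, ← natCast_zsmul, hR5, ← map_nsmul] at h5
  exact ⟨Q₁, toGeom_injective h5⟩

/-! ### Every rational point is `≡ iT₂ + jP₁ + kP₂ (mod 5E(ℚ))` -/

/-- **`E(ℚ) = ⟨T₂, P₁, P₂⟩ + 5E(ℚ)`** (unreduced form): for every `P ∈ E(ℚ)` there are `i, j, k ∈ ℕ`
and `Y ∈ E(ℚ)` with `P + (iT₂ + jP₁ + kP₂) = 5Y`. (`P = O`: trivial; `P = T = k'T₂` and `5T₂ = O`;
otherwise the translate of `exists_translate_f_eq_pow` is `O`, or `T`, or in `5E(ℚ)` by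
`exists_eq_five_nsmul_of_f_eq_pow`.) [cite: SilvermanAEC2009, Thm. X.1.1 and Exercise 10.1] -/
theorem exists_add_combination_eq (P : E.toAffine.Point) :
    ∃ (i j k : ℕ) (Y : E.toAffine.Point), P + (i • T₂ + j • P₁ + k • P₂) = (5 : ℕ) • Y := by
  obtain ⟨k', hk'5, hk'⟩ := exists_T_eq_nsmul_T₂
  have hTk : T + (5 - k') • T₂ = 0 := by
    rw [hk', ← add_nsmul, Nat.add_sub_cancel' hk'5.le, five_nsmul_T₂]
  by_cases hP0 : P = 0
  · subst hP0
    exact ⟨0, 0, 0, 0, by simp only [zero_nsmul, add_zero, nsmul_zero]⟩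
  rcases P with _ | ⟨x, y, h⟩
  · exact absurd rfl hP0
  by_cases hT : x = 0 ∧ y = 0
  · -- `P = T`
    obtain ⟨rfl, rfl⟩ := hT
    refine ⟨5 - k', 0, 0, 0, ?_⟩
    rw [zero_nsmul, zero_nsmul, add_zero, add_zero, nsmul_zero, ← hTk, T]
  obtain ⟨i, j, k, -, -, -, hmain⟩ := exists_translate_f_eq_pow h hT
  by_cases hO : Affine.Point.some x y h + i • T₂ + j • P₁ + k • P₂ = 0
  · -- the translate is `O`
    refine ⟨i, j, k, 0, ?_⟩
    rw [nsmul_zero, ← hO]; abel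
  rcases hP'' : Affine.Point.some x y h + i • T₂ + j • P₁ + k • P₂ with _ | ⟨x'', y'', h''⟩
  · exact absurd hP'' hO
  by_cases hT'' : x'' = 0 ∧ y'' = 0
  · -- the translate is `T = k' T₂`
    obtain ⟨rfl, rfl⟩ := hT''
    have ePT : Affine.Point.some x y h + i • T₂ + j • P₁ + k • P₂ = T := by rw [hP'', T]
    refine ⟨i + (5 - k'), j, k, 0, ?_⟩
    rw [nsmul_zero, ← hTk, ← ePT, add_nsmul]; abel
  · obtain ⟨t, ht0, hft⟩ := hmain x'' y'' h'' hP'' hT''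
    obtain ⟨Q₁, hQ₁⟩ := exists_eq_five_nsmul_of_f_eq_pow h'' hT'' ht0 hft
    refine ⟨i, j, k, Q₁, ?_⟩
    rw [← hQ₁, ← hP'']; abel

/-- Reduction of an integer multiple modulo `5`: `z X = r X + 5((z / 5) X)` with `0 ≤ r = z mod 5 < 5`.
[folklore] -/
private theorem exists_zsmul_eq_nsmul_add (z : ℤ) (X : E.toAffine.Point) :
    ∃ r : ℕ, r < 5 ∧ z • X = r • X + (5 : ℕ) • ((z / 5) • X) := by
  refine ⟨(z % 5).toNat, by omega, ?_⟩
  have hz : z = ((z % 5).toNat : ℤ) + ((5 : ℕ) : ℤ) * (z / 5) := by omega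
  conv_lhs => rw [hz]
  rw [add_zsmul, natCast_zsmul, mul_zsmul, natCast_zsmul]

/-- **`E(ℚ) = ⟨T₂, P₁, P₂⟩ + 5E(ℚ)`** with reduced coefficients: every `P ∈ E(ℚ)` is
`iT₂ + jP₁ + kP₂ + 5Y` with `i, j, k < 5`. [cite: SilvermanAEC2009, Thm. X.1.1 and Exercise 10.1] -/
theorem exists_eq_combination_add (P : E.toAffine.Point) :
    ∃ (i j k : ℕ) (Y : E.toAffine.Point), i < 5 ∧ j < 5 ∧ k < 5 ∧
      P = i • T₂ + j • P₁ + k • P₂ + (5 : ℕ) • Y := by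
  obtain ⟨i, j, k, Y, hY⟩ := exists_add_combination_eq P
  have e : P = (5 : ℕ) • Y + (-(i : ℤ)) • T₂ + (-(j : ℤ)) • P₁ + (-(k : ℤ)) • P₂ := by
    rw [neg_zsmul, neg_zsmul, neg_zsmul, natCast_zsmul, natCast_zsmul, natCast_zsmul, ← hY]; abel
  obtain ⟨r₁, hr₁, e₁⟩ := exists_zsmul_eq_nsmul_add (-(i : ℤ)) T₂
  obtain ⟨r₂, hr₂, e₂⟩ := exists_zsmul_eq_nsmul_add (-(j : ℤ)) P₁
  obtain ⟨r₃, hr₃, e₃⟩ := exists_zsmul_eq_nsmul_add (-(k : ℤ)) P₂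
  refine ⟨r₁, r₂, r₃, Y + (-(i : ℤ) / 5) • T₂ + (-(j : ℤ) / 5) • P₁ + (-(k : ℤ) / 5) • P₂,
    hr₁, hr₂, hr₃, ?_⟩
  rw [e, e₁, e₂, e₃, nsmul_add, nsmul_add, nsmul_add]
  abel

/-! ### `#E(ℚ)/5E(ℚ) = 125` and `rank E(ℚ) = 2` -/

/-- **`#E(ℚ)/5E(ℚ) ≤ 125`**: the classes of `iT₂ + jP₁ + kP₂`, `i, j, k < 5`, exhaust the quotient.
[cite: SilvermanAEC2009, Thm. X.1.1 and Exercise 10.1] -/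
theorem card_quotient_le :
    Nat.card (E.toAffine.Point ⧸
      (nsmulAddMonoidHom (5 : ℕ) : E.toAffine.Point →+ E.toAffine.Point).range) ≤ 125 := by
  set N := (nsmulAddMonoidHom (5 : ℕ) : E.toAffine.Point →+ E.toAffine.Point).range with hN
  let g : Fin 5 × Fin 5 × Fin 5 → E.toAffine.Point ⧸ N :=
    fun t ↦ ((t.1.val • T₂ + t.2.1.val • P₁ + t.2.2.val • P₂ : E.toAffine.Point) : E.toAffine.Point ⧸ N)
  have hg : Function.Surjective g := by
    intro q
    obtain ⟨P, rfl⟩ := QuotientAddGroup.mk_surjective q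
    obtain ⟨i, j, k, Y, hi, hj, hk, e⟩ := exists_eq_combination_add P
    refine ⟨(⟨i, hi⟩, ⟨j, hj⟩, ⟨k, hk⟩), ?_⟩
    simp only [g]
    rw [QuotientAddGroup.eq_iff_sub_mem, hN, AddMonoidHom.mem_range]
    refine ⟨-Y, ?_⟩
    rw [nsmulAddMonoidHom_apply, e, neg_nsmul]
    abel
  have := Nat.card_le_card_of_surjective g hg
  simpa using this

/-- **`#E(ℚ)/5E(ℚ) = 125`**, i.e. `E(ℚ)/5E(ℚ) ≅ (ℤ/5)³` generated by `2T`, `(-78, 936)`, `(98, 392)`.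
[cite: SilvermanAEC2009, Thm. X.1.1 and Exercise 10.1] -/
theorem card_quotient_eq :
    Nat.card (E.toAffine.Point ⧸
      (nsmulAddMonoidHom (5 : ℕ) : E.toAffine.Point →+ E.toAffine.Point).range) = 125 :=
  le_antisymm card_quotient_le card_quotient_ge

/-- **`rank E_{13/14}(ℚ) ≤ 2`.** [cite: SilvermanAEC2009, Thm. X.1.1 and Exercise 10.1] -/
theorem mordellWeilRank_le_two : E.mordellWeilRank ≤ 2 := by
  have hcard := natCard_quotient_nsmulRange_eq E.toAffine.Point 5
  rw [natCard_torsionBy_five, card_quotient_eq] at hcard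
  have hr : E.mordellWeilRank = Module.finrank ℤ E.toAffine.Point := by
    unfold WeierstrassCurve.mordellWeilRank; congr!
  rw [hr]
  have h25 : 5 ^ Module.finrank ℤ E.toAffine.Point ≤ 5 ^ 2 := by
    have : 5 ^ Module.finrank ℤ E.toAffine.Point * 5 ≤ 25 * 5 := by rw [← hcard]
    exact le_of_mul_le_mul_right this (by norm_num)
  exact (Nat.pow_le_pow_iff_right (by norm_num)).mp h25

/-- **`rank E_{13/14}(ℚ) = 2`** — the Mordell–Weil rank of the Kubert–Tate curve
`y² + xy - 2548y = x³ - 182x²`, computed unconditionally by the `5`-descent on rational points.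
[cite: SilvermanAEC2009, Thm. X.1.1 and Exercise 10.1] -/
theorem mordellWeilRank_eq_two : E.mordellWeilRank = 2 :=
  le_antisymm mordellWeilRank_le_two two_le_mordellWeilRank

end KubertTate1314Descent

end Literature.NumberTheory.EllipticCurves

end
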